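import Mathlib.NumberTheory.NumberField.Units.DirichletTheorem
import Literature.AlgebraicGeometry.Frobenioids.ArithmeticDivisorsMonoidIsoInfinitePlaces
import Literature.AlgebraicGeometry.Frobenioids.ArithmeticFrobenioidModel
import HarnessLib

/-!
# Frobenioids I, Example 6.3: a monoid automorphism of the effective arithmetic divisors `Φ(K)` of a
# number field that fixes every PRINCIPAL divisor is the identity

Mochizuki, *The geometry of Frobenioids I: the general theory*, Kyushu J. Math. **62** (2008) 293–400, §6,
Example 6.3 pp. 112–114 (`Φ(F) = ⊕_{v ∈ V(F)} ord(O_v^▷)`, the natural homomorphism `B(F) = F^× → Φ(F)^gp`,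
`f ↦ div(f)`) [cite: MochizukiFrdI2008, Ex. 6.3 p.113]; context: Thm. 6.4 (iii)/(iv) pp. 115–116 (an
isomorphism of such monoids is a bijection of places, generator to generator at the finite places, monomial at
the archimedean ones — in the tree as `EffArithDivisor.exists_decomposition_monomial[_mulEquiv]`,
abc-iut-L1-d7 / abc-iut-w4-d090).

PROOF-ONLY file (cell abc-iut, row R82 «PHI-RIGID-PRINC@ARITH-DIVISOR», abc-iut-L5-lead RULINGS #149 (5); seat
abc-iut-L5-t1 gen 13; directory word abc-iut-L1-lead R221/R226).  CLASSICAL algebraic number theory about the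
tree's model `EffArithDivisor K = (FinitePlace K →₀ ℕ) × (InfinitePlace K → ℝ≥0)` (`ArithmeticDivisors.lean`),
no Frobenioid-categorical input (the first three are `private` classical helpers):

* `exists_ordFin_ne_zero_and_eq_zero_of_ne` — two distinct finite places `w ≠ w'` are separated by a
  principal divisor: some `x ∈ K^×` has `ord_w(x) ≠ 0 = ord_{w'}(x)` (an integer of `𝔭_w ∖ 𝔭_{w'}`);
* `exists_unit_log_pos_and_log_neg` — two distinct infinite places `v ≠ v'` are separated IN SIGN by a unit:
  some `u ∈ 𝓞_K^×` has `log|u|_v > 0 > log|u|_{v'}` (Mathlib's Dirichlet unit `exists_unit` at `v` and the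
  product formula `sum_mult_mul_log`);
* `infinitePlace_apply_two` — `|2|_v = 2` at every infinite place;
* **`EffArithDivisor.mulEquiv_apply_eq_self_of_map_principal`** — if `θ : Φ(K) ⥲ Φ(K)` is a monoid
  automorphism whose groupification `θ^gp : Φ(K)^gp ⥲ Φ(K)^gp` (`MonGp.map θ`, [FrdI] §0) fixes the divisor
  `div(w) ∈ Φ(K)^gp` of every `w ∈ K^×` (the tree's `Div_B` of Example 6.3: `(gpEquiv K)⁻¹ (principalArithDivisorHom K w)`,
  `ArithmeticFrobenioidModel.lean`), then `θ = id`.  PROOF: by the structure theorem `θ (f, t) = (π_* f, σ_* (c · t))`;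
  the extension of `θ` to `Φ^gp = ArithDivisor K` has the same shape on principal divisors
  (`ArithDivisor.fin_apply_of_restrict` / `arch_apply_of_restrict`), so `ord_{π w}(x) = ord_w(x)` and
  `-log|x|_{σ v} = c_v · (-log|x|_v)` for all `x ∈ K^×`; the first bullet forces `π = id`, the second `σ = id`
  (opposite signs against `c_v ≥ 0`), the third `c_v = 1` (`log 2 ≠ 0`).
* `EffArithDivisor.mulEquiv_eq_refl_of_map_principal` — the same, as `θ = MulEquiv.refl _`.

The principal-divisor hypothesis is load-bearing and DISPLAYED: a bare monoid automorphism of `Φ(K)` may permute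
places and rescale archimedean coordinates.  Consumed by abc-iut-L5-t11's [IUTchI] Cor 5.3 (i) census at the
arithmetic global model (binder `hΦ` of `Cor53iArithHratOfMonoidRigidity`), where `Φ^⊛(A) = Φ(K_A)` objectwise.
No definitions, no named facts, no instances; nothing here bears on [IUTchIII] Cor. 3.12 or asserts anything
about abc.
-/

noncomputable section

namespace Literature.AlgebraicGeometry.Frobenioids

open NumberField

/-! ### Separation of places by principal divisors (classical) -/

section Separation

variable {K : Type*} [Field K] [NumberField K]

/-- **Distinct finite places are separated by a principal divisor**: for finite places `w ≠ w'` of a number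
field `K` there is `x ∈ K^×` with `ord_w(x) ≠ 0` and `ord_{w'}(x) = 0` — any integer in `𝔭_w ∖ 𝔭_{w'}`
(distinct maximal ideals of the Dedekind domain `𝓞_K` are incomparable). [folklore] -/
private theorem exists_ordFin_ne_zero_and_eq_zero_of_ne {w w' : FinitePlace K} (h : w ≠ w') :
    ∃ x : Kˣ, ordFin K w x ≠ 0 ∧ ordFin K w' x = 0 := by
  -- an integer in `𝔭_w ∖ 𝔭_{w'}`
  obtain ⟨a, ha1, ha2⟩ : ∃ a : 𝓞 K, a ∈ w.maximalIdeal.asIdeal ∧ a ∉ w'.maximalIdeal.asIdeal := by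
    by_contra! H
    exact h ((FinitePlace.maximalIdeal_inj w w').mp (IsDedekindDomain.HeightOneSpectrum.ext
      (Ideal.IsMaximal.eq_of_le (IsDedekindDomain.HeightOneSpectrum.isMaximal _) Ideal.IsPrime.ne_top' H)))
  have ha0 : algebraMap (𝓞 K) K a ≠ 0 :=
    RingOfIntegers.coe_ne_zero_iff.mpr fun h0 => ha2 (h0 ▸ zero_mem _)
  refine ⟨Units.mk0 (algebraMap (𝓞 K) K a) ha0, ?_, ?_⟩
  · rw [ne_eq, ← apply_eq_one_iff_ordFin_eq_zero, Units.val_mk0, ← FinitePlace.norm_embedding_eq]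
    exact ((FinitePlace.norm_lt_one_iff_mem K w.maximalIdeal a).mpr ha1).ne
  · rw [← apply_eq_one_iff_ordFin_eq_zero, Units.val_mk0, ← FinitePlace.norm_embedding_eq]
    exact (FinitePlace.norm_eq_one_iff_notMem K w'.maximalIdeal a).mpr ha2

/-- **Distinct infinite places are separated in sign by a unit**: for infinite places `v ≠ v'` of a number
field `K` there is a unit `u ∈ 𝓞_K^×` with `log|u|_v > 0` and `log|u|_{v'} < 0` — Dirichlet's unit at `v`
(`log|u|_w < 0` for all `w ≠ v`, Mathlib `NumberField.Units.dirichletUnitTheorem.exists_unit`) together with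
the product formula `Σ_w [K_w:ℝ] log|u|_w = 0`. [folklore] -/
private theorem exists_unit_log_pos_and_log_neg {v v' : InfinitePlace K} (h : v' ≠ v) :
    ∃ u : (𝓞 K)ˣ, 0 < Real.log (v (algebraMap (𝓞 K) K u)) ∧ Real.log (v' (algebraMap (𝓞 K) K u)) < 0 := by
  classical
  obtain ⟨u, hu⟩ := NumberField.Units.dirichletUnitTheorem.exists_unit K v
  refine ⟨u, ?_, hu v' h⟩
  have hsum := NumberField.Units.sum_mult_mul_log u
  rw [← Finset.add_sum_erase _ _ (Finset.mem_univ v)] at hsum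
  have hneg : ∑ w ∈ Finset.univ.erase v, (w.mult : ℝ) * Real.log (w (algebraMap (𝓞 K) K u)) < 0 :=
    Finset.sum_neg (fun w hw => mul_neg_of_pos_of_neg (Nat.cast_pos.mpr InfinitePlace.mult_pos)
      (hu w (Finset.ne_of_mem_erase hw))) ⟨v', Finset.mem_erase.mpr ⟨h, Finset.mem_univ _⟩⟩
  have hv : 0 < (v.mult : ℝ) * Real.log (v (algebraMap (𝓞 K) K u)) := by linarith
  exact pos_of_mul_pos_right hv (Nat.cast_nonneg _)

omit [NumberField K] in
/-- `|2|_v = 2` at every infinite place `v` (the place is the norm of a complex embedding). [folklore] -/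
private theorem infinitePlace_apply_two (v : InfinitePlace K) : v (2 : K) = 2 := by
  rw [← InfinitePlace.norm_embedding_eq, map_ofNat, Complex.norm_ofNat]

end Separation

/-! ### Rigidity of `Φ(K)` under automorphisms fixing the principal divisors -/

namespace EffArithDivisor

variable {K : Type} [Field K] [NumberField K]

/-- The identification `Φ(K)^gp ≅ ArithDivisor K` (`gpEquiv`) carries the image of an effective divisor `D` in
the groupification to `D` viewed as an arithmetic divisor. [cite: MochizukiFrdI2008, Ex. 6.3 p.113] -/
theorem gpEquiv_symm_ofAdd_toArithDivisor (D : EffArithDivisor K) :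
    (EffArithDivisor.gpEquiv K).symm (Multiplicative.ofAdd (EffArithDivisor.toArithDivisor K D)) =
      Algebra.GrothendieckGroup.of (Multiplicative.ofAdd D) := by
  apply (EffArithDivisor.gpEquiv K).injective
  rw [MulEquiv.apply_symm_apply, EffArithDivisor.gpEquiv_apply, EffArithDivisor.gpHom_of, toAdd_ofAdd]

/-- **Rigidity of the arithmetic divisor monoid under automorphisms fixing principal divisors.**  Let `K` be a
number field and `θ : Φ(K) ⥲ Φ(K)` a monoid automorphism of the effective arithmetic divisors
(`Multiplicative (EffArithDivisor K)`, the divisor monoid of the model Frobenioid `C_{K̃/F}` of [FrdI] Ex. 6.3 at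
`Spec K`) whose groupification `θ^gp = MonGp.map θ : Φ(K)^gp → Φ(K)^gp` fixes the principal divisor
`Div_B(w) = gpEquiv⁻¹(div w)` of every `w ∈ B(K) = K^×`.  Then `θ` is the identity.  (Structure theorem of
Thm. 6.4 (iv) at the constructions, `exists_decomposition_monomial_mulEquiv`: `θ (f, t) = (π_* f, σ_* (c·t))`;
principal divisors force `π = id` — distinct primes are separated by an integer —, `σ = id` — Dirichlet's unit at
`v` has `log|u|_v > 0 > log|u|_{σ v}` against `c_v ≥ 0` —, and `c_v = 1` — `|2|_v = 2 ≠ 1`.)  The hypothesis is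
load-bearing: without it `θ` may permute places and rescale archimedean coordinates.  (A classical property
OF THE DATA `(Φ, B, B → Φ^gp)` of Ex. 6.3 p. 113 — not a numbered statement of [FrdI]; it is the arithmetic input
to [IUTchI] Cor. 5.3 (i) at the arithmetic global model.) [cite: MochizukiFrdI2008, Ex. 6.3 p.113] -/
theorem mulEquiv_apply_eq_self_of_map_principal
    (θ : Multiplicative (EffArithDivisor K) ≃* Multiplicative (EffArithDivisor K))
    (hθ : ∀ w : Kˣ, MonGp.map θ.toMonoidHom ((EffArithDivisor.gpEquiv K).symm (principalArithDivisorHom K w)) =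
      (EffArithDivisor.gpEquiv K).symm (principalArithDivisorHom K w))
    (x : Multiplicative (EffArithDivisor K)) : θ x = x := by
  classical
  -- (S1) structure: `θ (f, t) = (π_* f, σ_* (c · t))`
  obtain ⟨π, σ, c, -, -, h1, h2⟩ := EffArithDivisor.exists_decomposition_monomial_mulEquiv θ
  -- the additive shadow `eE` of `θ` and its extension `eG` to `Φ^gp = ArithDivisor K`
  let eE : EffArithDivisor K →+ EffArithDivisor K := (AddEquiv.toMultiplicative.symm θ).toAddMonoidHom
  have heE : ∀ D, eE D = Multiplicative.toAdd (θ (Multiplicative.ofAdd D)) := fun D => rfl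
  let θG : Multiplicative (ArithDivisor K) →* Multiplicative (ArithDivisor K) :=
    (EffArithDivisor.gpEquiv K).toMonoidHom.comp
      ((MonGp.map θ.toMonoidHom).comp (EffArithDivisor.gpEquiv K).symm.toMonoidHom)
  let eG : ArithDivisor K →+ ArithDivisor K := AddMonoidHom.toMultiplicative.symm θG
  have heG_apply : ∀ d, eG d = Multiplicative.toAdd ((EffArithDivisor.gpEquiv K)
      (MonGp.map θ.toMonoidHom ((EffArithDivisor.gpEquiv K).symm (Multiplicative.ofAdd d)))) := fun d => rfl
  have heG : ∀ D, eG (EffArithDivisor.toArithDivisor K D) = EffArithDivisor.toArithDivisor K (eE D) := by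
    intro D
    rw [heG_apply, gpEquiv_symm_ofAdd_toArithDivisor, MonGp.map_of, EffArithDivisor.gpEquiv_apply,
      EffArithDivisor.gpHom_of, toAdd_ofAdd]
    rfl
  -- principal divisors are fixed by `eG`
  have hfix : ∀ w : Kˣ, eG (principalArithDivisor K w) = principalArithDivisor K w := by
    intro w
    rw [heG_apply]
    change Multiplicative.toAdd ((EffArithDivisor.gpEquiv K) (MonGp.map θ.toMonoidHom
      ((EffArithDivisor.gpEquiv K).symm (principalArithDivisorHom K w)))) = _
    rw [hθ w, MulEquiv.apply_symm_apply]
    rfl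
  have h1' : ∀ D : EffArithDivisor K, (eE D).1 = Finsupp.equivMapDomain π D.1 := fun D => h1 D
  have h2' : ∀ (D : EffArithDivisor K) (v : InfinitePlace K), (eE D).2 (σ v) = c v * D.2 v :=
    fun D v => h2 D v
  -- finite coordinates of principal divisors: `ord_{π w}(u) = ord_w(u)`
  have hfin : ∀ (u : Kˣ) (w : FinitePlace K), ordFin K (π w) u = ordFin K w u := by
    intro u w
    have h := ArithDivisor.fin_apply_of_restrict eG eE heG h1' (principalArithDivisor K u) w
    rwa [hfix, principalArithDivisor_fst, principalArithDivisor_fst] at h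
  -- archimedean coordinates: `-log|u|_{σ v} = c_v · (-log|u|_v)`
  have harch : ∀ (u : Kˣ) (v : InfinitePlace K),
      -Real.log ((σ v) (u : K)) = c v * -Real.log (v (u : K)) := by
    intro u v
    have h := ArithDivisor.arch_apply_of_restrict eG eE heG h2' (principalArithDivisor K u) v
    rwa [hfix, principalArithDivisor_snd, principalArithDivisor_snd] at h
  -- (S2) `π = id`: distinct primes are separated by a principal divisor
  have hπ : ∀ w, π w = w := by
    intro w
    by_contra hne
    obtain ⟨u, hu1, hu2⟩ := exists_ordFin_ne_zero_and_eq_zero_of_ne (K := K) (Ne.symm hne)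
    exact hu1 ((hfin u w).symm.trans hu2)
  -- (S3) `σ = id`: Dirichlet's unit at `v` has opposite signs at `v` and `σ v ≠ v`
  have hσ : ∀ v, σ v = v := by
    intro v
    by_contra hne
    obtain ⟨u, hpos, hneg⟩ := exists_unit_log_pos_and_log_neg (K := K) hne
    have h := harch (Units.map (algebraMap (𝓞 K) K : 𝓞 K →* K) u) v
    have hcoe : ((Units.map (algebraMap (𝓞 K) K : 𝓞 K →* K) u : Kˣ) : K) = algebraMap (𝓞 K) K u := rfl
    rw [hcoe] at h
    have hc0 : (0 : ℝ) ≤ c v := (c v).coe_nonneg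
    nlinarith
  -- (S4) `c_v = 1`: `|2|_v = 2`
  have hc1 : ∀ v, c v = 1 := by
    intro v
    have h := harch (Units.mk0 (2 : K) two_ne_zero) v
    rw [hσ v, Units.val_mk0, infinitePlace_apply_two] at h
    have hlog : Real.log 2 ≠ 0 := (Real.log_pos one_lt_two).ne'
    have h' : ((c v : ℝ) - 1) * Real.log 2 = 0 := by linarith
    have h'' : (c v : ℝ) = 1 := by
      rcases mul_eq_zero.mp h' with h' | h'
      · linarith
      · exact absurd h' hlog
    exact_mod_cast h''
  -- conclusion: `θ = id`
  have hE : ∀ D : EffArithDivisor K, eE D = D := by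
    intro D
    refine Prod.ext (Finsupp.ext fun a => ?_) (funext fun v => ?_)
    · rw [h1', Finsupp.equivMapDomain_apply]
      congr 1
      rw [Equiv.symm_apply_eq]
      exact (hπ a).symm
    · have h := h2' D v
      rwa [hσ v, hc1 v, one_mul] at h
  have hx := hE (Multiplicative.toAdd x)
  rw [heE] at hx
  exact Multiplicative.toAdd.injective hx

/-- The same rigidity, stated as `θ = 1`: a monoid automorphism of `Φ(K)` whose groupification fixes every
principal divisor is `MulEquiv.refl`. [cite: MochizukiFrdI2008, Ex. 6.3 p.113] -/
theorem mulEquiv_eq_refl_of_map_principal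
    (θ : Multiplicative (EffArithDivisor K) ≃* Multiplicative (EffArithDivisor K))
    (hθ : ∀ w : Kˣ, MonGp.map θ.toMonoidHom ((EffArithDivisor.gpEquiv K).symm (principalArithDivisorHom K w)) =
      (EffArithDivisor.gpEquiv K).symm (principalArithDivisorHom K w)) :
    θ = MulEquiv.refl _ :=
  MulEquiv.ext (mulEquiv_apply_eq_self_of_map_principal θ hθ)

end EffArithDivisor

end Literature.AlgebraicGeometry.Frobenioids

end
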